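import Literature.Computability.QuantumComplexity.QueryRestriction
import Literature.Computability.QuantumComplexity.ExactHalfQueryAlgorithm
import Literature.Computability.QuantumComplexity.MajorityQueryAlgorithm
import HarnessLib

/-!
# `Q_E(EXACT_k^n) = max{k, n−k}` and `Q_E(Th_k^n) = max{k, n−k+1}` (Ambainis–Iraids–Smotrovs 2013, Cor. 1 / Cor. 2)

Topic `Computability/QuantumComplexity`. A. Ambainis, J. Iraids, J. Smotrovs, *Exact quantum query
complexity of EXACT and THRESHOLD*, TQC 2013 [AmbainisIraidsSmotrovs2013] (held text
`paper:arxiv-1302.1235`), §3 and §4, read on the page: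

> **Corollary 1.** [MJM11] `Q_E(EXACT_k^n) ≤ max{k, n−k}`. *Proof.* Assume that `k < n/2`. The other case
> is symmetric. Then we append the input `x` with `n − 2k` ones producing `x'` and call
> `EXACT_{n−k}^{2n−2k}(x')`. Then concluding that there are `n − k` ones in `x'` is equivalent to there being
> `(n−k) − (n−2k) = k` ones in the original input `x`. (p. 5 L51–57)
>
> **Corollary 2.** If `0 < k < n`, then `Q_E(Th_k^n) ≤ max{k, n−k+1}`. *Proof.* Assume that `k ≤ n/2`. The
> other case is symmetric. Then we append the input `x` with `n − 2k + 1` ones producing `x'` and call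
> `MAJ_{2n−2k+1}(x')`. Then `x'` containing at least `n − k + 1` ones is equivalent to `x` containing at least
> `(n−k+1) − (n−2k+1) = k` ones. (p. 6 L43–52)

with the matching floors Prop. 2 (`Q_E(EXACT_k^n) ≥ max{k, n−k}`, p. 5 L64–75) and Prop. 3
(`Q_E(Th_k^n) ≥ max{k, n−k+1}`, p. 6 L55–65), so that both inequalities are the printed EQUALITIES
("[MJM11] conjectured that its quantum query complexity is `max{k, n−k}`. In this paper we prove the
conjecture. […] The quantum query complexity of `THRESHOLD_k^n` turns out to be `max{k, n−k+1}`", p. 3 L38–47).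

In the tree's model `QQueryAlg` [BealsEtAl2001, §2] (`Q_E = quantumQueryComplexity 0`, `|x| = Grover.hw x`)
every ingredient is already typed BY NAME, and this file is the printed two-line assembly:

* the two algorithms: `ExactHalf.quantumQueryComplexity_exactHalf_le` (Thm. 1, `Q_ε(EXACT_k^{2k}) ≤ k`) and
  `Majority.quantumQueryComplexity_maj_le` (Thm. 2, `Q_ε(MAJ_{2k+1}) ≤ k + 1`);
* the padding step "append the input with constants and call the bigger function":
  `QueryRestriction.quantumQueryComplexity_append_le`, with the relabelling `Fin (n + C) ≃ Fin (2m)` /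
  `Fin (2m+1)` carried by `QueryRestriction.quantumQueryComplexity_comp_equiv` (`hw_append`, `hw_comp_equiv`);
* the floors `ExactThreshold.le_quantumQueryComplexity_zero_exactWeight` (Prop. 2) and
  `ExactThreshold.le_quantumQueryComplexity_zero_threshold` (Prop. 3).

Results: **`quantumQueryComplexity_exact_le`** (`Q_ε(EXACT_k^n) ≤ max{k, n−k}`, every `0 ≤ ε`, `k ≤ n`),
**`quantumQueryComplexity_zero_exact`** (`Q_E(EXACT_k^n) = max{k, n−k}`), **`quantumQueryComplexity_threshold_le`**
(`Q_ε(Th_k^n) ≤ max{k, n−k+1}`, `1 ≤ k ≤ n`), **`quantumQueryComplexity_zero_threshold`**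
(`Q_E(Th_k^n) = max{k, n−k+1}`). The printed side condition `0 < k < n` of Cor. 2 is relaxed to `1 ≤ k ≤ n`
(`k = n` is `AND_n`, value `n = max{n, 1}`); `k = 0` and `k = n + 1` are the constant functions. Everything is
proved; no fact, instance, notation or axiom is introduced.

## References

* [AmbainisIraidsSmotrovs2013] A. Ambainis, J. Iraids, J. Smotrovs, *Exact quantum query complexity of EXACT
  and THRESHOLD*, Proc. TQC 2013 (LIPIcs 22) 263–269; arXiv:1302.1235 — Def. 1 / Cor. 1 / Prop. 2 (§3, p. 5),
  Def. 2 / Cor. 2 / Prop. 3 (§4, p. 6); Cor. 1 is credited there to [MJM11] = A. Montanaro, R. Jozsa,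
  G. Mitchison, *On exact quantum query complexity*, Algorithmica 71 (2015) 775–796 (arXiv:1111.0475).
* [BealsEtAl2001] R. Beals, H. Buhrman, R. Cleve, M. Mosca, R. de Wolf, *Quantum lower bounds by
  polynomials*, J. ACM 48(4) (2001) 778–797 — §2 (the query model).
-/

noncomputable section

namespace Literature.Computability.QuantumComplexity.ExactThresholdValues

open Finset Literature.Computability.Cryptography
open Literature.Computability.QuantumComplexity.Grover (hw)
open Literature.Computability.QuantumComplexity.QueryRestriction (quantumQueryComplexity_append_le
  quantumQueryComplexity_comp_equiv)
open Literature.Computability.QuantumComplexity.ExactThreshold (le_quantumQueryComplexity_zero_exactWeight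
  le_quantumQueryComplexity_zero_threshold)

variable {N M : ℕ}

/-! ### Hamming weight of padded and relabelled inputs -/

/-- The weight as a sum of indicators. [cite: AmbainisIraidsSmotrovs2013, Def. 1] -/
theorem hw_eq_sum (x : Fin N → Bool) : hw x = ∑ i, if x i = true then 1 else 0 := by
  rw [Grover.hw, Finset.card_filter]

/-- Relabelling the variables along `Fin M ≃ Fin N` preserves the weight. [cite: AmbainisIraidsSmotrovs2013, Def. 1] -/
theorem hw_comp_equiv (e : Fin M ≃ Fin N) (x : Fin N → Bool) : hw (x ∘ e) = hw x := by
  rw [hw_eq_sum, hw_eq_sum]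
  exact Fintype.sum_equiv e _ _ fun i => rfl

/-- **"Append the input `x` with constants producing `x'`"**: the weight of the padded input is
`|x| + |c|`. [cite: AmbainisIraidsSmotrovs2013, Cor. 1 (proof)] -/
theorem hw_append (x : Fin N → Bool) (c : Fin M → Bool) : hw (Fin.append x c) = hw x + hw c := by
  rw [hw_eq_sum, hw_eq_sum, hw_eq_sum, Fin.sum_univ_add]
  simp only [Fin.append_left, Fin.append_right]

/-- Appending `M` ones adds `M` to the weight. [cite: AmbainisIraidsSmotrovs2013, Cor. 1 (proof)] -/
theorem hw_append_true (x : Fin N → Bool) : hw (Fin.append x fun _ : Fin M => true) = hw x + M := by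
  rw [hw_append, hw_eq_sum fun _ : Fin M => true]
  simp

/-- Appending zeros keeps the weight ("the other case is symmetric"). [cite: AmbainisIraidsSmotrovs2013, Cor. 1 (proof)] -/
theorem hw_append_false (x : Fin N → Bool) : hw (Fin.append x fun _ : Fin M => false) = hw x := by
  rw [hw_append, hw_eq_sum fun _ : Fin M => false]
  simp

/-! ### Corollary 1: `Q_E(EXACT_k^n) = max{k, n−k}` -/

/-- Thm. 1 transported to any index type `Fin L` with `L = 2m`: `Q_ε([ |x| = m ]) ≤ m` on `L` variables.
[cite: AmbainisIraidsSmotrovs2013, Thm. 1] -/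
theorem quantumQueryComplexity_exactWeight_le_of_eq_two_mul {L m : ℕ} (hL : L = 2 * m) {ε : ℝ} (hε : 0 ≤ ε) :
    quantumQueryComplexity ε (fun x : Fin L → Bool => decide (hw x = m)) ≤ m := by
  have h := quantumQueryComplexity_comp_equiv (finCongr hL.symm) hε
    (fun y : Fin (2 * m) → Bool => decide (hw y = m))
  simp only [hw_comp_equiv] at h
  rw [h]
  exact ExactHalf.quantumQueryComplexity_exactHalf_le hε

/-- **[AIS13, Cor. 1] `Q_ε(EXACT_k^n) ≤ max{k, n−k}`** (`k ≤ n`, every `0 ≤ ε`): pad with `n − 2k` ones and run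
the `EXACT_{n−k}^{2(n−k)}` algorithm when `2k ≤ n`, pad with `2k − n` zeros and run `EXACT_k^{2k}` otherwise.
[cite: AmbainisIraidsSmotrovs2013, Cor. 1] -/
theorem quantumQueryComplexity_exact_le {n k : ℕ} (hk : k ≤ n) {ε : ℝ} (hε : 0 ≤ ε) :
    quantumQueryComplexity ε (fun x : Fin n → Bool => decide (hw x = k)) ≤ max k (n - k) := by
  by_cases h2 : 2 * k ≤ n
  · -- append `n − 2k` ones and call `EXACT_{n−k}^{2n−2k}`
    have hL : n + (n - 2 * k) = 2 * (n - k) := by omega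
    have hbig := quantumQueryComplexity_exactWeight_le_of_eq_two_mul hL hε
    have hpad := quantumQueryComplexity_append_le (N := n) (fun _ : Fin (n - 2 * k) => true) hε
      (fun y : Fin (n + (n - 2 * k)) → Bool => decide (hw y = n - k))
    have hfun : (fun x : Fin n → Bool => decide (hw (Fin.append x fun _ : Fin (n - 2 * k) => true) = n - k)) =
        fun x => decide (hw x = k) := by
      funext x
      rw [hw_append_true]
      by_cases hx : hw x = k
      · rw [hx, decide_eq_true (by omega), decide_eq_true rfl]
      · rw [decide_eq_false (by omega), decide_eq_false hx]
    rw [hfun] at hpad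
    exact hpad.trans (hbig.trans (le_max_right _ _))
  · -- append `2k − n` zeros and call `EXACT_k^{2k}`
    have hL : n + (2 * k - n) = 2 * k := by omega
    have hbig := quantumQueryComplexity_exactWeight_le_of_eq_two_mul hL hε
    have hpad := quantumQueryComplexity_append_le (N := n) (fun _ : Fin (2 * k - n) => false) hε
      (fun y : Fin (n + (2 * k - n)) → Bool => decide (hw y = k))
    simp only [hw_append_false] at hpad
    exact hpad.trans (hbig.trans (le_max_left _ _))

/-- **[AIS13, Cor. 1 with Prop. 2] `Q_E(EXACT_k^n) = max{k, n−k}`** for `k ≤ n` (the conjecture of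
Montanaro–Jozsa–Mitchison). [cite: AmbainisIraidsSmotrovs2013, Cor. 1] -/
theorem quantumQueryComplexity_zero_exact {n k : ℕ} (hk : k ≤ n) :
    quantumQueryComplexity 0 (fun x : Fin n → Bool => decide (hw x = k)) = max k (n - k) :=
  le_antisymm (quantumQueryComplexity_exact_le hk le_rfl) (le_quantumQueryComplexity_zero_exactWeight hk)

/-! ### Corollary 2: `Q_E(Th_k^n) = max{k, n−k+1}` -/

/-- Thm. 2 transported to any index type `Fin L` with `L = 2m + 1`: `Q_ε([ m + 1 ≤ |x| ]) ≤ m + 1` on `L`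
variables. [cite: AmbainisIraidsSmotrovs2013, Thm. 2] -/
theorem quantumQueryComplexity_threshold_le_of_eq_two_mul_add_one {L m : ℕ} (hL : L = 2 * m + 1) {ε : ℝ}
    (hε : 0 ≤ ε) : quantumQueryComplexity ε (fun x : Fin L → Bool => decide (m + 1 ≤ hw x)) ≤ m + 1 := by
  have h := quantumQueryComplexity_comp_equiv (finCongr hL.symm) hε
    (fun y : Fin (2 * m + 1) → Bool => decide (m + 1 ≤ hw y))
  simp only [hw_comp_equiv] at h
  rw [h]
  exact Majority.quantumQueryComplexity_maj_le hε

/-- **[AIS13, Cor. 2] `Q_ε(Th_k^n) ≤ max{k, n−k+1}`** (`1 ≤ k ≤ n`, every `0 ≤ ε`): pad with `n − 2k + 1` ones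
and run `MAJ_{2n−2k+1}` when `2k ≤ n + 1`, pad with `2k − n − 1` zeros and run `MAJ_{2k−1}` otherwise.
[cite: AmbainisIraidsSmotrovs2013, Cor. 2] -/
theorem quantumQueryComplexity_threshold_le {n k : ℕ} (hk₁ : 1 ≤ k) (hk : k ≤ n) {ε : ℝ} (hε : 0 ≤ ε) :
    quantumQueryComplexity ε (fun x : Fin n → Bool => decide (k ≤ hw x)) ≤ max k (n - k + 1) := by
  by_cases h2 : 2 * k ≤ n + 1
  · -- append `n − 2k + 1` ones and call `MAJ_{2n−2k+1} = Th_{n−k+1}^{2(n−k)+1}`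
    have hL : n + (n + 1 - 2 * k) = 2 * (n - k) + 1 := by omega
    have hbig := quantumQueryComplexity_threshold_le_of_eq_two_mul_add_one hL hε
    have hpad := quantumQueryComplexity_append_le (N := n) (fun _ : Fin (n + 1 - 2 * k) => true) hε
      (fun y : Fin (n + (n + 1 - 2 * k)) → Bool => decide (n - k + 1 ≤ hw y))
    have hfun : (fun x : Fin n → Bool =>
        decide (n - k + 1 ≤ hw (Fin.append x fun _ : Fin (n + 1 - 2 * k) => true))) = fun x => decide (k ≤ hw x) := by
      funext x
      rw [hw_append_true]
      by_cases hx : k ≤ hw x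
      · rw [decide_eq_true (by omega), decide_eq_true hx]
      · rw [decide_eq_false (by omega), decide_eq_false hx]
    rw [hfun] at hpad
    exact hpad.trans (hbig.trans (le_max_right _ _))
  · -- append `2k − n − 1` zeros and call `MAJ_{2k−1} = Th_k^{2(k−1)+1}`
    have hL : n + (2 * k - 1 - n) = 2 * (k - 1) + 1 := by omega
    have hbig := quantumQueryComplexity_threshold_le_of_eq_two_mul_add_one hL hε
    rw [show k - 1 + 1 = k by omega] at hbig
    have hpad := quantumQueryComplexity_append_le (N := n) (fun _ : Fin (2 * k - 1 - n) => false) hε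
      (fun y : Fin (n + (2 * k - 1 - n)) → Bool => decide (k ≤ hw y))
    simp only [hw_append_false] at hpad
    exact hpad.trans (hbig.trans (le_max_left _ _))

/-- **[AIS13, Cor. 2 with Prop. 3] `Q_E(Th_k^n) = max{k, n−k+1}`** for `1 ≤ k ≤ n`.
[cite: AmbainisIraidsSmotrovs2013, Cor. 2] -/
theorem quantumQueryComplexity_zero_threshold {n k : ℕ} (hk₁ : 1 ≤ k) (hk : k ≤ n) :
    quantumQueryComplexity 0 (fun x : Fin n → Bool => decide (k ≤ hw x)) = max k (n - k + 1) :=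
  le_antisymm (quantumQueryComplexity_threshold_le hk₁ hk le_rfl) (le_quantumQueryComplexity_zero_threshold hk₁ hk)

/-! ### The constant cases (`k > n` for `EXACT`, `k = 0` or `k > n` for `Th`) -/

/-- `EXACT_k^n` with `k > n` is the constant `0`: no queries (`n ≥ 1`). [cite: AmbainisIraidsSmotrovs2013, Def. 1] -/
theorem quantumQueryComplexity_exact_of_lt {n k : ℕ} (hn : 0 < n) (h : n < k) {ε : ℝ} (hε : 0 ≤ ε) :
    quantumQueryComplexity ε (fun x : Fin n → Bool => decide (hw x = k)) = 0 := by
  have hf : (fun x : Fin n → Bool => decide (hw x = k)) = fun _ => false := by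
    funext x
    have := Grover.hw_le x
    exact decide_eq_false (by omega)
  rw [hf]
  exact QueryRestriction.quantumQueryComplexity_const hn hε false

/-- `Th_0^n` is the constant `1`: no queries (`n ≥ 1`). [cite: AmbainisIraidsSmotrovs2013, Def. 2] -/
theorem quantumQueryComplexity_threshold_zero_left {n : ℕ} (hn : 0 < n) {ε : ℝ} (hε : 0 ≤ ε) :
    quantumQueryComplexity ε (fun x : Fin n → Bool => decide (0 ≤ hw x)) = 0 := by
  have hf : (fun x : Fin n → Bool => decide (0 ≤ hw x)) = fun _ => true := by
    funext x
    exact decide_eq_true (Nat.zero_le _)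
  rw [hf]
  exact QueryRestriction.quantumQueryComplexity_const hn hε true

/-- `Th_k^n` with `k > n` is the constant `0`: no queries (`n ≥ 1`). [cite: AmbainisIraidsSmotrovs2013, Def. 2] -/
theorem quantumQueryComplexity_threshold_of_lt {n k : ℕ} (hn : 0 < n) (h : n < k) {ε : ℝ} (hε : 0 ≤ ε) :
    quantumQueryComplexity ε (fun x : Fin n → Bool => decide (k ≤ hw x)) = 0 := by
  have hf : (fun x : Fin n → Bool => decide (k ≤ hw x)) = fun _ => false := by
    funext x
    have := Grover.hw_le x
    exact decide_eq_false (by omega)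
  rw [hf]
  exact QueryRestriction.quantumQueryComplexity_const hn hε false

/-! ### Checks -/

/-- `Q_E(EXACT_2^5) = 3` (pad with one `1` and run `EXACT_3^6` with `3` queries; floor Prop. 2).
[cite: AmbainisIraidsSmotrovs2013, Cor. 1] -/
example : quantumQueryComplexity 0 (fun x : Fin 5 → Bool => decide (hw x = 2)) = 3 :=
  quantumQueryComplexity_zero_exact (by norm_num)

/-- `Q_E(EXACT_2^4) = 2`, the Montanaro–Jozsa–Mitchison algorithm's value. [cite: AmbainisIraidsSmotrovs2013, Cor. 1] -/
example : quantumQueryComplexity 0 (fun x : Fin 4 → Bool => decide (hw x = 2)) = 2 :=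
  quantumQueryComplexity_zero_exact (by norm_num)

/-- `Q_E(Th_2^6) = 5` (pad with three `1`s and run `MAJ_9` with `5` queries; floor Prop. 3).
[cite: AmbainisIraidsSmotrovs2013, Cor. 2] -/
example : quantumQueryComplexity 0 (fun x : Fin 6 → Bool => decide (2 ≤ hw x)) = 5 :=
  quantumQueryComplexity_zero_threshold (by norm_num) (by norm_num)

/-- `Q_E(Th_5^6) = 5` (pad with three `0`s and run `MAJ_9`). [cite: AmbainisIraidsSmotrovs2013, Cor. 2] -/
example : quantumQueryComplexity 0 (fun x : Fin 6 → Bool => decide (5 ≤ hw x)) = 5 :=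
  quantumQueryComplexity_zero_threshold (by norm_num) (by norm_num)

end Literature.Computability.QuantumComplexity.ExactThresholdValues

end
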